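import Literature.NumberTheory.LFunctions.ConreyIwaniec2002SpacingMechanism
import HarnessLib

/-!
# Conrey–Iwaniec (2002), Proposition 9.1: the real-variable algebra of its proof (p. 20 L9–38)

Conrey–Iwaniec, *Spacing of zeros of Hecke L-functions and the class number problem*, Acta Arith.
103 (2002), §9 [held text `paper:arxiv-math_0111012` p0020:L1–44]. The derivation of (9.7),
`E(T) ≪ T(log q)^6 + Tℒ(T)^{1/2}(log T)²(log q)^{5/2}`, from Proposition 8.1:
`ℓM̄ − x = (ℓ − xN̄)M̄ + x·B̄` with `MN = 1 + B`, hence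
`E ≤ D^{1/2}(Σ|M|²)^{1/2} + (sup|x|)Σ|B|` (Cauchy), then `D ≪ T(log q)^7 + Tℒ(T)(log T)^4` (8.10),
`Σ|M|² ≪ T(log q)^5`, `|x| ≪ log T`, `Σ|B| ≪ T(log q)²(Σ_{q²<m≤q⁴}τ²(m,χ)/m)^{1/2}(Σ_{n≤q⁴}τ²(n)/n)^{1/2}`
and (6.49). This file isolates the pure real/complex ALGEBRA of that page (no number theory), so
that the composition (`ConreyIwaniec2002Prop91Large.lean`) elaborates quickly. Everything PROVED.

Two points made explicit here that the printed page leaves implicit: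
* the term `(log T)Σ_s|B(s)| ≪ Tℒ(q)^{1/2}(log T)(log q)^{9/2}` is absorbed by the second term of
  (9.7) exactly when `(log q)² ≤ log T` (`offdiagonal_term_le`; the range of the `_large` form);
* the remainder `(q/X)^{1/2} ≈ q^{−1/2}` of (6.49) at `X = q²`, dropped in print, is absorbed
  EFFECTIVELY: by `T(log q)^6` when `(log T)⁴ ≤ q(log q)⁸` and by the second term otherwise, using
  only `L(1,χ)²q ≥ 1` (`remainder_absorb`).

## References
* [ConreyIwaniec2002] B. Conrey, H. Iwaniec, Acta Arith. 103 (2002) 259–312, §9 p. 20,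
  Proposition 9.1 (9.7).
-/

noncomputable section

open scoped NumberField
open Complex

namespace Literature.NumberTheory.LFunctions

namespace ConreyIwaniec2002

/-! ### Kernel composition, step 1: real-variable algebra of p. 20 L9–38 -/

/-- `√(x + y) ≤ √x + √y`. [folklore] -/
private theorem sqrt_add_le_sqrt_add_sqrt {x y : ℝ} (hx : 0 ≤ x) (hy : 0 ≤ y) :
    Real.sqrt (x + y) ≤ Real.sqrt x + Real.sqrt y := by
  have hsx := Real.sqrt_nonneg x
  have hsy := Real.sqrt_nonneg y
  have h : x + y ≤ (Real.sqrt x + Real.sqrt y) ^ 2 := by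
    rw [add_sq, Real.sq_sqrt hx, Real.sq_sqrt hy]
    nlinarith [mul_nonneg hsx hsy]
  calc Real.sqrt (x + y) ≤ Real.sqrt ((Real.sqrt x + Real.sqrt y) ^ 2) := Real.sqrt_le_sqrt h
    _ = Real.sqrt x + Real.sqrt y := Real.sqrt_sq (by positivity)

/-- **The remainder of (6.49) is absorbed effectively.** With `ℓ = log q ≥ 1`, `ℓ² ≤ LT = log T`,
`L1 = L(1,χ)` with `L1² q ≥ 1` (class number formula), `r = (q/X)^{1/2}` with `r² q ≤ 1`
(`X = q² + 1`) and `L1² LT ≤ ℒ(T)`: `T·LT·ℓ⁴·√r ≤ Tℓ⁶ + T ℒ(T)^{1/2} LT² ℓ^{5/2}` — by `Tℓ⁶` when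
`LT⁴ ≤ qℓ⁸`, by the second term otherwise. [cite: ConreyIwaniec2002, §9 p. 20 (use of (6.49))] -/
theorem remainder_absorb {T LT ℓ L1 q r cLT : ℝ} (hT : 0 ≤ T) (hℓ : 1 ≤ ℓ) (hℓLT : ℓ ^ 2 ≤ LT)
    (hL1 : 0 ≤ L1) (hq : 0 < q) (hL1q : 1 ≤ L1 ^ 2 * q) (hr : 0 ≤ r) (hrq : r ^ 2 * q ≤ 1)
    (hcLT : L1 ^ 2 * LT ≤ cLT) :
    T * LT * ℓ ^ 4 * Real.sqrt r ≤
      T * ℓ ^ 6 + T * Real.sqrt cLT * LT ^ 2 * ℓ ^ ((5 : ℝ) / 2) := by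
  set s : ℝ := Real.sqrt r with hs
  have hs0 : 0 ≤ s := Real.sqrt_nonneg r
  have hs2 : s ^ 2 = r := Real.sq_sqrt hr
  have hs4 : s ^ 4 = r ^ 2 := by rw [show (4 : ℕ) = 2 * 2 by norm_num, pow_mul, hs2]
  have hℓ0 : 0 < ℓ := by linarith
  have hLT1 : 1 ≤ LT := le_trans (by nlinarith) hℓLT
  have hLT0 : 0 < LT := by linarith
  have hP0 : 0 ≤ T * ℓ ^ 6 := by positivity
  have hcLT0 : 0 ≤ cLT := le_trans (by positivity) hcLT
  have hQ0 : 0 ≤ T * Real.sqrt cLT * LT ^ 2 * ℓ ^ ((5 : ℝ) / 2) := by positivity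
  -- `ℓ² ≤ ℓ^{5/2}` and `L1 √LT ≤ √ℒ(T)`
  have hℓ52 : ℓ ^ 2 ≤ ℓ ^ ((5 : ℝ) / 2) := by
    rw [show ℓ ^ 2 = ℓ ^ ((2 : ℕ) : ℝ) from (Real.rpow_natCast ℓ 2).symm]
    exact Real.rpow_le_rpow_of_exponent_le hℓ (by norm_num)
  have hL1sq : L1 * Real.sqrt LT ≤ Real.sqrt cLT := by
    have h1 : L1 * Real.sqrt LT = Real.sqrt (L1 ^ 2 * LT) := by
      rw [Real.sqrt_mul (by positivity), Real.sqrt_sq hL1]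
    rw [h1]
    exact Real.sqrt_le_sqrt hcLT
  by_cases hcase : LT ^ 4 ≤ q * ℓ ^ 8
  · -- case A: `LT·s ≤ ℓ²`, the remainder is `≤ Tℓ⁶`
    have h4 : (LT * s) ^ 4 ≤ (ℓ ^ 2) ^ 4 := by
      have e1 : (LT * s) ^ 4 = LT ^ 4 * r ^ 2 := by rw [mul_pow, hs4]
      have e2 : (ℓ ^ 2) ^ 4 = ℓ ^ 8 := by ring
      rw [e1, e2]
      have hr2 : 0 ≤ r ^ 2 := by positivity
      calc LT ^ 4 * r ^ 2 ≤ (q * ℓ ^ 8) * r ^ 2 := by gcongr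
        _ = ℓ ^ 8 * (r ^ 2 * q) := by ring
        _ ≤ ℓ ^ 8 * 1 := by gcongr
        _ = ℓ ^ 8 := mul_one _
    have hLTs : LT * s ≤ ℓ ^ 2 :=
      (pow_le_pow_iff_left₀ (by positivity) (by positivity) (by norm_num : (4 : ℕ) ≠ 0)).mp h4
    calc T * LT * ℓ ^ 4 * s = T * ℓ ^ 4 * (LT * s) := by ring
      _ ≤ T * ℓ ^ 4 * ℓ ^ 2 := by gcongr
      _ = T * ℓ ^ 6 := by ring
      _ ≤ T * ℓ ^ 6 + T * Real.sqrt cLT * LT ^ 2 * ℓ ^ ((5 : ℝ) / 2) := le_add_of_nonneg_right hQ0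
  · -- case B: `ℓ² s ≤ L1·LT·√LT`, the remainder is `≤` the second term
    push Not at hcase
    set u : ℝ := ℓ ^ 2 * s with hu
    set v : ℝ := L1 * LT * Real.sqrt LT with hv
    have hu0 : 0 ≤ u := by positivity
    have hv0 : 0 ≤ v := by positivity
    have hsLT : Real.sqrt LT ^ 2 = LT := Real.sq_sqrt hLT0.le
    have hu4 : u ^ 4 = ℓ ^ 8 * r ^ 2 := by
      rw [hu, mul_pow, hs4]; ring
    have hv4 : v ^ 4 = L1 ^ 4 * LT ^ 6 := by
      rw [hv, mul_pow, mul_pow, show (4 : ℕ) = 2 * 2 by norm_num, pow_mul (Real.sqrt LT), hsLT]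
      ring
    have huv4 : u ^ 4 ≤ v ^ 4 := by
      rw [hu4, hv4]
      -- `ℓ⁸ r² q² ≤ LT⁴ ≤ LT⁶ ≤ L1⁴ LT⁶ q²`
      have h1 : ℓ ^ 8 * r ^ 2 * q ^ 2 ≤ LT ^ 4 := by
        calc ℓ ^ 8 * r ^ 2 * q ^ 2 = (q * ℓ ^ 8) * (r ^ 2 * q) := by ring
          _ ≤ LT ^ 4 * 1 := by gcongr
          _ = LT ^ 4 := mul_one _
      have h2 : LT ^ 4 ≤ LT ^ 6 := pow_le_pow_right₀ hLT1 (by norm_num)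
      have h3 : LT ^ 6 ≤ L1 ^ 4 * LT ^ 6 * q ^ 2 := by
        have : (1 : ℝ) ≤ (L1 ^ 2 * q) ^ 2 := one_le_pow₀ hL1q
        calc LT ^ 6 = LT ^ 6 * 1 := (mul_one _).symm
          _ ≤ LT ^ 6 * (L1 ^ 2 * q) ^ 2 := by gcongr
          _ = L1 ^ 4 * LT ^ 6 * q ^ 2 := by ring
      have h4 : ℓ ^ 8 * r ^ 2 * q ^ 2 ≤ L1 ^ 4 * LT ^ 6 * q ^ 2 := h1.trans (h2.trans h3)
      exact le_of_mul_le_mul_right h4 (by positivity)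
    have huv : u ≤ v :=
      (pow_le_pow_iff_left₀ hu0 hv0 (by norm_num : (4 : ℕ) ≠ 0)).mp huv4
    calc T * LT * ℓ ^ 4 * s = T * LT * ℓ ^ 2 * u := by rw [hu]; ring
      _ ≤ T * LT * ℓ ^ 2 * v := by gcongr
      _ = T * (L1 * Real.sqrt LT) * LT ^ 2 * ℓ ^ 2 := by rw [hv]; ring
      _ ≤ T * Real.sqrt cLT * LT ^ 2 * ℓ ^ ((5 : ℝ) / 2) := by gcongr
      _ ≤ T * ℓ ^ 6 + T * Real.sqrt cLT * LT ^ 2 * ℓ ^ ((5 : ℝ) / 2) := le_add_of_nonneg_left hP0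

/-- **The diagonal term**: `D^{1/2}(Σ|M|²)^{1/2} ≤ √(C₁C₂)(Tℓ⁶ + Tℒ(T)^{1/2}LT²ℓ^{5/2})` from
`D ≤ C₁(Tℓ⁷ + Tℒ(T)LT⁴)` (Proposition 8.1) and `Σ|M|² ≤ C₂Tℓ⁵`.
[cite: ConreyIwaniec2002, §9 p. 20 L9–17] -/
theorem diagonal_term_le {C₁ C₂ T LT ℓ cLT D SM : ℝ} (hC₁ : 0 < C₁) (hC₂ : 0 < C₂) (hT : 0 ≤ T)
    (hℓ : 0 ≤ ℓ) (hcLT : 0 ≤ cLT)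
    (hD : D ≤ C₁ * (T * ℓ ^ 7 + T * cLT * LT ^ 4)) (hSM : SM ≤ C₂ * (T * ℓ ^ 5)) :
    Real.sqrt D * Real.sqrt SM ≤
      Real.sqrt (C₁ * C₂) * (T * ℓ ^ 6 + T * Real.sqrt cLT * LT ^ 2 * ℓ ^ ((5 : ℝ) / 2)) := by
  have hℓ52 : Real.sqrt (ℓ ^ 5) = ℓ ^ ((5 : ℝ) / 2) := by
    rw [Real.sqrt_eq_rpow, ← Real.rpow_natCast, ← Real.rpow_mul hℓ]
    norm_num
  have h1 : Real.sqrt D ≤ Real.sqrt (C₁ * (T * ℓ ^ 7)) + Real.sqrt (C₁ * (T * cLT * LT ^ 4)) := by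
    calc Real.sqrt D ≤ Real.sqrt (C₁ * (T * ℓ ^ 7) + C₁ * (T * cLT * LT ^ 4)) :=
          Real.sqrt_le_sqrt (by rw [← mul_add]; exact hD)
      _ ≤ _ := sqrt_add_le_sqrt_add_sqrt (by positivity) (by positivity)
  have h2 : Real.sqrt SM ≤ Real.sqrt (C₂ * (T * ℓ ^ 5)) := Real.sqrt_le_sqrt hSM
  have hA : Real.sqrt (C₁ * (T * ℓ ^ 7)) * Real.sqrt (C₂ * (T * ℓ ^ 5)) =
      Real.sqrt (C₁ * C₂) * (T * ℓ ^ 6) := by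
    rw [← Real.sqrt_mul (by positivity)]
    rw [show C₁ * (T * ℓ ^ 7) * (C₂ * (T * ℓ ^ 5)) = (C₁ * C₂) * (T * ℓ ^ 6) ^ 2 by ring,
      Real.sqrt_mul (by positivity), Real.sqrt_sq (by positivity)]
  have hB : Real.sqrt (C₁ * (T * cLT * LT ^ 4)) * Real.sqrt (C₂ * (T * ℓ ^ 5)) =
      Real.sqrt (C₁ * C₂) * (T * Real.sqrt cLT * LT ^ 2 * ℓ ^ ((5 : ℝ) / 2)) := by
    rw [← Real.sqrt_mul (by positivity)]
    rw [show C₁ * (T * cLT * LT ^ 4) * (C₂ * (T * ℓ ^ 5)) =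
        ((C₁ * C₂) * (T * LT ^ 2) ^ 2) * cLT * ℓ ^ 5 by ring,
      Real.sqrt_mul (by positivity), Real.sqrt_mul (by positivity), Real.sqrt_mul (by positivity),
      Real.sqrt_sq (by positivity), hℓ52]
    ring
  calc Real.sqrt D * Real.sqrt SM
      ≤ (Real.sqrt (C₁ * (T * ℓ ^ 7)) + Real.sqrt (C₁ * (T * cLT * LT ^ 4))) *
          Real.sqrt (C₂ * (T * ℓ ^ 5)) := by
        gcongr
    _ = Real.sqrt (C₁ * C₂) * (T * ℓ ^ 6) +
          Real.sqrt (C₁ * C₂) * (T * Real.sqrt cLT * LT ^ 2 * ℓ ^ ((5 : ℝ) / 2)) := by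
        rw [add_mul, hA, hB]
    _ = _ := by ring


/-- **The off-diagonal terms**: from the separated bilinear bounds for `B₁, B₂`, the coefficient
sums (`(1+4ℓ)⁴` and `C₅(8ℒ(q)ℓ + r)`), `|x| ≤ 3C₃ LT`, `ℒ(q) ≤ ℒ(T)` and `ℓ² ≤ LT`:
`(sup|x|)·Σ_s(|B₁|+|B₂|) ≤ 15000 C₃C₄√C₅ (Tℓ⁶ + Tℒ(T)^{1/2}LT²ℓ^{5/2})` — the honest form of the
printed `(log T)Σ_s|B(s)| ≪ Tℒ(q)^{1/2}(log T)(log q)^{9/2}` (FLAG 2: needs `(log q)² ≤ log T`) plus the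
remainder of (6.49) (`remainder_absorb`). [cite: ConreyIwaniec2002, §9 p. 20 L18–38] -/
theorem offdiagonal_term_le {C₃ C₄ C₅ T LT ℓ L1 q r cLT cLq XB SB₁ SB₂ A₁ Bn₁ A₂ Bn₂ : ℝ}
    (hC₃ : 0 < C₃) (hC₄ : 0 < C₄) (hC₅ : 0 < C₅) (hT : 0 ≤ T) (hℓ : 1 ≤ ℓ) (hℓLT : ℓ ^ 2 ≤ LT)
    (hL1 : 0 ≤ L1) (hq : 0 < q) (hL1q : 1 ≤ L1 ^ 2 * q) (hr : 0 ≤ r) (hrq : r ^ 2 * q ≤ 1)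
    (hcLq0 : 0 ≤ cLq) (hcLq : cLq ≤ cLT) (hcLT : L1 ^ 2 * LT ≤ cLT)
    (hXB : XB ≤ 3 * C₃ * LT) (hSB₁0 : 0 ≤ SB₁) (hSB₂0 : 0 ≤ SB₂)
    (hSB₁ : SB₁ ≤ C₄ * T * (1 + 4 * ℓ) * (1 + 4 * ℓ) * Real.sqrt A₁ * Real.sqrt Bn₁)
    (hSB₂ : SB₂ ≤ C₄ * T * (1 + 4 * ℓ) * (1 + 4 * ℓ) * Real.sqrt A₂ * Real.sqrt Bn₂)
    (hA₁ : A₁ ≤ C₅ * (8 * cLq * ℓ + r)) (hBn₁ : Bn₁ ≤ (1 + 4 * ℓ) ^ 4)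
    (hA₂ : A₂ ≤ (1 + 4 * ℓ) ^ 4) (hBn₂ : Bn₂ ≤ C₅ * (8 * cLq * ℓ + r)) :
    XB * (SB₁ + SB₂) ≤
      15000 * C₃ * C₄ * Real.sqrt C₅ *
        (T * ℓ ^ 6 + T * Real.sqrt cLT * LT ^ 2 * ℓ ^ ((5 : ℝ) / 2)) := by
  have hℓ0 : 0 < ℓ := by linarith
  have hℓ1 : (1 : ℝ) ≤ ℓ ^ 2 := one_le_pow₀ hℓ
  have hLT1 : 1 ≤ LT := hℓ1.trans hℓLT
  have hLT0 : 0 ≤ LT := by linarith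
  have hcLT0 : 0 ≤ cLT := hcLq0.trans hcLq
  set s : ℝ := Real.sqrt r with hs
  set P : ℝ := T * ℓ ^ 6 with hP
  set Q : ℝ := T * Real.sqrt cLT * LT ^ 2 * ℓ ^ ((5 : ℝ) / 2) with hQ
  have hP0 : 0 ≤ P := by positivity
  have hQ0 : 0 ≤ Q := by positivity
  have hs0 : 0 ≤ s := Real.sqrt_nonneg r
  -- the small square root: `√(C₅(8ℒ(q)ℓ + r)) ≤ √C₅ (3√(ℒ(T)ℓ) + s) =: W`
  set W : ℝ := Real.sqrt C₅ * (3 * Real.sqrt (cLT * ℓ) + s) with hWdef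
  have hW0 : 0 ≤ W := by positivity
  have hW : Real.sqrt (C₅ * (8 * cLq * ℓ + r)) ≤ W := by
    rw [hWdef, Real.sqrt_mul hC₅.le]
    refine mul_le_mul_of_nonneg_left ?_ (Real.sqrt_nonneg _)
    have h89 : 8 * cLq * ℓ ≤ 9 * (cLT * ℓ) := by
      have := mul_le_mul_of_nonneg_right hcLq hℓ0.le
      nlinarith [mul_nonneg hcLq0 hℓ0.le]
    have h9 : Real.sqrt (9 * (cLT * ℓ)) = 3 * Real.sqrt (cLT * ℓ) := by
      rw [Real.sqrt_mul (by norm_num), show (9 : ℝ) = 3 ^ 2 by norm_num,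
        Real.sqrt_sq (by norm_num)]
    calc Real.sqrt (8 * cLq * ℓ + r) ≤ Real.sqrt (8 * cLq * ℓ) + Real.sqrt r :=
          sqrt_add_le_sqrt_add_sqrt (by positivity) hr
      _ ≤ Real.sqrt (9 * (cLT * ℓ)) + s := add_le_add (Real.sqrt_le_sqrt h89) le_rfl
      _ = 3 * Real.sqrt (cLT * ℓ) + s := by rw [h9]
  -- the large square root: `√((1+4ℓ)⁴) = (1+4ℓ)² ≤ 25ℓ²`
  have h14 : 1 + 4 * ℓ ≤ 5 * ℓ := by linarith
  have h140 : 0 ≤ 1 + 4 * ℓ := by positivity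
  have hV : Real.sqrt ((1 + 4 * ℓ) ^ 4) ≤ 25 * ℓ ^ 2 := by
    rw [show (1 + 4 * ℓ) ^ 4 = ((1 + 4 * ℓ) ^ 2) ^ 2 by ring, Real.sqrt_sq (by positivity)]
    calc (1 + 4 * ℓ) ^ 2 ≤ (5 * ℓ) ^ 2 := pow_le_pow_left₀ h140 h14 2
      _ = 25 * ℓ ^ 2 := by ring
  -- each `SB_i ≤ 625 C₄ T ℓ⁴ W`
  have hA₁' : Real.sqrt A₁ ≤ W := (Real.sqrt_le_sqrt hA₁).trans hW
  have hBn₁' : Real.sqrt Bn₁ ≤ 25 * ℓ ^ 2 := (Real.sqrt_le_sqrt hBn₁).trans hV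
  have hA₂' : Real.sqrt A₂ ≤ 25 * ℓ ^ 2 := (Real.sqrt_le_sqrt hA₂).trans hV
  have hBn₂' : Real.sqrt Bn₂ ≤ W := (Real.sqrt_le_sqrt hBn₂).trans hW
  have hC₄T : 0 ≤ C₄ * T := by positivity
  have hSB₁' : SB₁ ≤ 625 * C₄ * T * ℓ ^ 4 * W := by
    calc SB₁ ≤ C₄ * T * (1 + 4 * ℓ) * (1 + 4 * ℓ) * Real.sqrt A₁ * Real.sqrt Bn₁ := hSB₁
      _ ≤ C₄ * T * (5 * ℓ) * (5 * ℓ) * W * (25 * ℓ ^ 2) := by gcongr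
      _ = 625 * C₄ * T * ℓ ^ 4 * W := by ring
  have hSB₂' : SB₂ ≤ 625 * C₄ * T * ℓ ^ 4 * W := by
    calc SB₂ ≤ C₄ * T * (1 + 4 * ℓ) * (1 + 4 * ℓ) * Real.sqrt A₂ * Real.sqrt Bn₂ := hSB₂
      _ ≤ C₄ * T * (5 * ℓ) * (5 * ℓ) * (25 * ℓ ^ 2) * W := by gcongr
      _ = 625 * C₄ * T * ℓ ^ 4 * W := by ring
  -- multiply by `|x| ≤ 3C₃LT`
  have hprod : XB * (SB₁ + SB₂) ≤ (3 * C₃ * LT) * (1250 * C₄ * T * ℓ ^ 4 * W) := by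
    have h12 : SB₁ + SB₂ ≤ 1250 * C₄ * T * ℓ ^ 4 * W := by linarith
    have h120 : 0 ≤ SB₁ + SB₂ := by positivity
    exact mul_le_mul hXB h12 h120 (by positivity)
  -- (a) `T·LT·ℓ⁴·√(ℒ(T)ℓ) ≤ Q` by `ℓ² ≤ LT`
  have hℓ52 : Real.sqrt ℓ * ℓ ^ 2 = ℓ ^ ((5 : ℝ) / 2) := by
    rw [Real.sqrt_eq_rpow, show ℓ ^ 2 = ℓ ^ ((2 : ℕ) : ℝ) from (Real.rpow_natCast ℓ 2).symm,
      ← Real.rpow_add hℓ0]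
    norm_num
  have ha : T * LT * ℓ ^ 4 * Real.sqrt (cLT * ℓ) ≤ Q := by
    rw [Real.sqrt_mul hcLT0]
    have hsc : 0 ≤ T * Real.sqrt cLT := by positivity
    have hsl : 0 ≤ Real.sqrt ℓ * ℓ ^ 2 := by positivity
    calc T * LT * ℓ ^ 4 * (Real.sqrt cLT * Real.sqrt ℓ)
        = T * Real.sqrt cLT * (LT * ℓ ^ 2) * (Real.sqrt ℓ * ℓ ^ 2) := by ring
      _ ≤ T * Real.sqrt cLT * (LT * LT) * (Real.sqrt ℓ * ℓ ^ 2) := by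
          apply mul_le_mul_of_nonneg_right _ hsl
          apply mul_le_mul_of_nonneg_left _ hsc
          exact mul_le_mul_of_nonneg_left hℓLT hLT0
      _ = Q := by rw [hℓ52, hQ]; ring
  -- (b) the remainder
  have hb : T * LT * ℓ ^ 4 * s ≤ P + Q :=
    remainder_absorb hT hℓ hℓLT hL1 hq hL1q hr hrq hcLT
  -- assemble
  set K₀ : ℝ := 3750 * C₃ * C₄ * Real.sqrt C₅ with hK₀
  have hK0 : 0 ≤ K₀ := by positivity
  have hexp : (3 * C₃ * LT) * (1250 * C₄ * T * ℓ ^ 4 * W) =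
      K₀ * (3 * (T * LT * ℓ ^ 4 * Real.sqrt (cLT * ℓ)) + T * LT * ℓ ^ 4 * s) := by
    rw [hWdef, hK₀]; ring
  have hin : 3 * (T * LT * ℓ ^ 4 * Real.sqrt (cLT * ℓ)) + T * LT * ℓ ^ 4 * s ≤
      3 * Q + (P + Q) := by linarith
  have hKP : 0 ≤ K₀ * P := mul_nonneg hK0 hP0
  calc XB * (SB₁ + SB₂) ≤ (3 * C₃ * LT) * (1250 * C₄ * T * ℓ ^ 4 * W) := hprod
    _ = K₀ * (3 * (T * LT * ℓ ^ 4 * Real.sqrt (cLT * ℓ)) + T * LT * ℓ ^ 4 * s) := hexp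
    _ ≤ K₀ * (3 * Q + (P + Q)) := mul_le_mul_of_nonneg_left hin hK0
    _ = 4 * K₀ * (P + Q) - 3 * (K₀ * P) := by ring
    _ ≤ 4 * K₀ * (P + Q) := by linarith
    _ = 15000 * C₃ * C₄ * Real.sqrt C₅ *
        (T * ℓ ^ 6 + T * Real.sqrt cLT * LT ^ 2 * ℓ ^ ((5 : ℝ) / 2)) := by
        rw [hK₀, hP, hQ]; ring

/-- **The arithmetic of Proposition 9.1** (pure real algebra, isolated so that the composition
elaborates quickly): `E ≤ D^{1/2}(Σ|M|²)^{1/2} + (sup|x|)Σ(|B₁|+|B₂|)` together with Proposition 8.1,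
the mean square of `M`, the separated bilinear bounds, the coefficient sums, Corollary 6.3 and
`L(1,χ) ≥ π/√q` give (9.7) with `C₀ = √(C₁C₂) + 15000 C₃C₄√C₅`.
[cite: ConreyIwaniec2002, Proposition 9.1 (9.7)] -/
theorem prop91_algebra {C₁ C₂ C₃ C₄ C₅ T LT ℓ L1 q r cLT cLq D SM E XB SB₁ SB₂ A₁ Bn₁ A₂ Bn₂ : ℝ}
    (hC₁ : 0 < C₁) (hC₂ : 0 < C₂) (hC₃ : 0 < C₃) (hC₄ : 0 < C₄) (hC₅ : 0 < C₅)
    (hT : 0 ≤ T) (hℓ : 1 ≤ ℓ) (hℓLT : ℓ ^ 2 ≤ LT)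
    (hL1 : 0 ≤ L1) (hq : 0 < q) (hL1q : 1 ≤ L1 ^ 2 * q) (hr : 0 ≤ r) (hrq : r ^ 2 * q ≤ 1)
    (hcLq0 : 0 ≤ cLq) (hcLq : cLq ≤ cLT) (hcLT : L1 ^ 2 * LT ≤ cLT)
    (hE : E ≤ Real.sqrt D * Real.sqrt SM + XB * (SB₁ + SB₂))
    (hD : D ≤ C₁ * (T * ℓ ^ 7 + T * cLT * LT ^ 4)) (hSM : SM ≤ C₂ * (T * ℓ ^ 5))
    (hXB : XB ≤ 3 * C₃ * LT) (hSB₁0 : 0 ≤ SB₁) (hSB₂0 : 0 ≤ SB₂)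
    (hSB₁ : SB₁ ≤ C₄ * T * (1 + 4 * ℓ) * (1 + 4 * ℓ) * Real.sqrt A₁ * Real.sqrt Bn₁)
    (hSB₂ : SB₂ ≤ C₄ * T * (1 + 4 * ℓ) * (1 + 4 * ℓ) * Real.sqrt A₂ * Real.sqrt Bn₂)
    (hA₁ : A₁ ≤ C₅ * (8 * cLq * ℓ + r)) (hBn₁ : Bn₁ ≤ (1 + 4 * ℓ) ^ 4)
    (hA₂ : A₂ ≤ (1 + 4 * ℓ) ^ 4) (hBn₂ : Bn₂ ≤ C₅ * (8 * cLq * ℓ + r)) :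
    E ≤ (Real.sqrt (C₁ * C₂) + 15000 * C₃ * C₄ * Real.sqrt C₅) *
      (T * ℓ ^ (6 : ℕ) + T * Real.sqrt cLT * LT ^ (2 : ℕ) * ℓ ^ ((5 : ℝ) / 2)) := by
  have hcLT0 : 0 ≤ cLT := hcLq0.trans hcLq
  have h1 := diagonal_term_le hC₁ hC₂ hT (by linarith) hcLT0 hD hSM
  have h2 := offdiagonal_term_le hC₃ hC₄ hC₅ hT hℓ hℓLT hL1 hq hL1q hr hrq hcLq0 hcLq hcLT hXB
    hSB₁0 hSB₂0 hSB₁ hSB₂ hA₁ hBn₁ hA₂ hBn₂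
  calc E ≤ Real.sqrt D * Real.sqrt SM + XB * (SB₁ + SB₂) := hE
    _ ≤ _ := by rw [add_mul]; exact add_le_add h1 h2


/-! ### Kernel composition, step 2: the pointwise identity and the two Cauchy–Schwarz steps -/

/-- **`ℓM̄ − x = (ℓ − xN̄)M̄ + x·conj(MN − 1)`**, hence, with `MN − 1 = B₁ + B₂` and `|x| ≤ X`,
`|ℓM̄ − x| ≤ |ℓ − xN̄||M| + X(|B₁| + |B₂|)`. [cite: ConreyIwaniec2002, §9 p. 20 L9–12] -/
theorem pointwise_E_le {ℓs xs Ms Ns b₁ b₂ : ℂ} {X : ℝ} (hMN : Ms * Ns - 1 = b₁ + b₂)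
    (hx : ‖xs‖ ≤ X) :
    ‖ℓs * starRingEnd ℂ Ms - xs‖ ≤
      ‖ℓs - xs * starRingEnd ℂ Ns‖ * ‖Ms‖ + X * (‖b₁‖ + ‖b₂‖) := by
  have hid : ℓs * starRingEnd ℂ Ms - xs =
      (ℓs - xs * starRingEnd ℂ Ns) * starRingEnd ℂ Ms + xs * starRingEnd ℂ (Ms * Ns - 1) := by
    simp only [map_mul, map_sub, map_one]; ring
  rw [hid]
  have h1 : ‖(ℓs - xs * starRingEnd ℂ Ns) * starRingEnd ℂ Ms‖ =
      ‖ℓs - xs * starRingEnd ℂ Ns‖ * ‖Ms‖ := by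
    rw [norm_mul, Complex.norm_conj]
  have h2 : ‖xs * starRingEnd ℂ (Ms * Ns - 1)‖ ≤ X * (‖b₁‖ + ‖b₂‖) := by
    rw [norm_mul, Complex.norm_conj, hMN]
    exact mul_le_mul hx (norm_add_le _ _) (norm_nonneg _) ((norm_nonneg _).trans hx)
  calc ‖(ℓs - xs * starRingEnd ℂ Ns) * starRingEnd ℂ Ms + xs * starRingEnd ℂ (Ms * Ns - 1)‖
      ≤ ‖(ℓs - xs * starRingEnd ℂ Ns) * starRingEnd ℂ Ms‖ + ‖xs * starRingEnd ℂ (Ms * Ns - 1)‖ :=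
        norm_add_le _ _
    _ ≤ _ := by rw [h1]; exact add_le_add le_rfl h2

/-- **Summation with Cauchy's inequality**: from `e(t) ≤ a(t)b(t) + X(g₁(t) + g₂(t))` pointwise,
`Σe ≤ (Σa²)^{1/2}(Σb²)^{1/2} + X(Σg₁ + Σg₂)`. [cite: ConreyIwaniec2002, §9 p. 20 L9–12] -/
theorem sum_le_sqrt_mul_sqrt_add {S : Finset ℝ} {e a b g₁ g₂ : ℝ → ℝ} {X : ℝ}
    (hpt : ∀ t ∈ S, e t ≤ a t * b t + X * (g₁ t + g₂ t))
    (ha : ∀ t ∈ S, 0 ≤ a t) (hb : ∀ t ∈ S, 0 ≤ b t) :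
    ∑ t ∈ S, e t ≤
      Real.sqrt (∑ t ∈ S, a t ^ 2) * Real.sqrt (∑ t ∈ S, b t ^ 2) +
        X * (∑ t ∈ S, g₁ t + ∑ t ∈ S, g₂ t) := by
  have hsum : ∑ t ∈ S, e t ≤ ∑ t ∈ S, (a t * b t + X * (g₁ t + g₂ t)) := Finset.sum_le_sum hpt
  have hsplit : ∑ t ∈ S, (a t * b t + X * (g₁ t + g₂ t)) =
      ∑ t ∈ S, a t * b t + X * (∑ t ∈ S, g₁ t + ∑ t ∈ S, g₂ t) := by
    have h1 : ∑ t ∈ S, (a t * b t + X * (g₁ t + g₂ t)) =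
        ∑ t ∈ S, a t * b t + ∑ t ∈ S, X * (g₁ t + g₂ t) := Finset.sum_add_distrib
    have h2 : ∑ t ∈ S, X * (g₁ t + g₂ t) = X * ∑ t ∈ S, (g₁ t + g₂ t) :=
      (Finset.mul_sum S (fun t => g₁ t + g₂ t) X).symm
    have h3 : ∑ t ∈ S, (g₁ t + g₂ t) = ∑ t ∈ S, g₁ t + ∑ t ∈ S, g₂ t := Finset.sum_add_distrib
    rw [h1, h2, h3]
  have hab0 : 0 ≤ ∑ t ∈ S, a t * b t := Finset.sum_nonneg fun t ht => mul_nonneg (ha t ht) (hb t ht)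
  have hCS : ∑ t ∈ S, a t * b t ≤ Real.sqrt (∑ t ∈ S, a t ^ 2) * Real.sqrt (∑ t ∈ S, b t ^ 2) := by
    have h := Finset.sum_mul_sq_le_sq_mul_sq S a b
    have ha2 : 0 ≤ ∑ t ∈ S, a t ^ 2 := Finset.sum_nonneg fun t _ => sq_nonneg _
    calc ∑ t ∈ S, a t * b t = Real.sqrt ((∑ t ∈ S, a t * b t) ^ 2) := (Real.sqrt_sq hab0).symm
      _ ≤ Real.sqrt ((∑ t ∈ S, a t ^ 2) * ∑ t ∈ S, b t ^ 2) := Real.sqrt_le_sqrt h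
      _ = Real.sqrt (∑ t ∈ S, a t ^ 2) * Real.sqrt (∑ t ∈ S, b t ^ 2) := Real.sqrt_mul ha2 _
  rw [hsplit] at hsum
  linarith


end ConreyIwaniec2002

end Literature.NumberTheory.LFunctions

end
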